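import Literature.AnabelianGeometry.EtaleTheta.Discharge.Sec5ThetaInputOfThetaTower
import Literature.IUT.HodgeTheaters.GenuineFKitMergeInputs
import HarnessLib

/-!
# Two SUMMAND LIFTS for the [IUTchI] Cor 5.3 (ii) bad slot at the Θ-side stand-in: (1) EVERY base self-equivalence lifts TAUTOLOGICALLY to the hull
# of a CONSTANT re-basing of a tempered Frobenioid ([EtTh] Def 3.6 (iv) model Frobenioid, all pull-backs identities); (2) lifts on the two
# summands of `X ⊕ Y` assemble to a lift on the sum (proof-only bookkeeping)

S. Mochizuki, *The étale theta function …* [MochizukiEtTh2009], Def. 3.6 (ii)/(iv) pp. 303–304 (PDF pp. 77–78): the base-field-theoretic hull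
`C^{bs-fld}` is «the model Frobenioid determined by the data `(D, Φ^{bs-fld}, F, F → (Φ^{bs-fld})^gp)`» [cite: MochizukiEtTh2009, Def 3.6 p.78];
*The geometry of Frobenioids I*, Thm. 5.2 (i) p. 100 (morphisms of a model Frobenioid = `(deg_Fr, Base, Div, u)`) [cite: MochizukiFrdI2008, Thm. 5.2(i) p.100];
*Inter-universal Teichmüller theory I*, kurims (May 2020), Cor. 5.3 (ii) p. 144 and the surjectivity argument printed for (iv), p. 144 l. 37–40
([IUTchI] Cor 5.3 (ii) p.144) [claim: Mochizuki2012, status: disputed] (D-0012 claim key; nothing of the series is asserted; no side is taken on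
[IUTchIII] Cor. 3.12).

PROOF-ONLY (cell abc-iut, seat abc-iut-L5-t4 gen 8, KEY R72 part (3), the generic half of file (L2); consumer: ★ `Cor53iiBadSlotLiftsAllThetaTower`
(stand-in (B) of record, abc-iut-L2-t7 ★ p510136, whose hull is `C_{A₀}^{bs-fld} ⊕ 𝒞⊢_v̲` with `C_{A₀}` = abc-iut-L2-t6's ★ `TemperedFrobenioid.constRebase`).
* §1 **`TemperedFrobenioid.exists_constRebase_hull_lift`** — for EVERY tempered Frobenioid `C`, object `A₀`, base `D'` and self-equivalence `Θ` of `D'`,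
  the hull category of `C.constRebase A₀ D'` has a self-equivalence `Ψ` with `Ψ ⋙ Base ≅ Base ⋙ Θ`: ALL pull-backs of the constant re-basing are
  identities (`constRebase_bsFld_pull_apply`, `…_bsFldMonoid_map_eq_id`, `…_pullGp_bsFldMonoid`, `…_cnstFnBsFunctor_map_apply`; cf. ★ `pull_constΦ_eq_id`),
  so `(A, α) ↦ (Θ A, α)`, `(d, f, Div, u) ↦ (d, Θ f, Div, u)` is a functor and an equivalence (inverse from `Θ⁻¹`, unit/counit over those of `Θ`).
  The fibres over `A` and `Θ A` are the same monoids DEFINITIONALLY; the proof moves elements by identity transports.  It carries NO arithmetic.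
* §2 **`CatIsomorphism.exists_sum_lift`** — lifts of `Θ` through `inl ⋙ q` (on `X`) and through `inr ⋙ q` (on `Y`) assemble to a lift through
  `q : X ⊕ Y ⥤ B` (`Functor.sum'`, `Functor.sumIsoExt`; as in ★ `Cor53iiBadSlotKernelAtStandIn` §0).
0 `def` · 0 `instance` · 0 notation · no `Prop` fact · no sorry; OURS; typed ≠ inhabited ≠ proved; nothing here asserts abc proved or refuted.
-/

noncomputable section

universe u₀ v₀ u v u' v' w

open CategoryTheory Opposite

/-! ### §1. The tautological lift of a base self-equivalence to the hull of a CONSTANT re-basing -/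

namespace Literature.AnabelianGeometry.EtaleTheta

namespace TemperedFrobenioid

open Literature.AlgebraicGeometry.Frobenioids

variable {D₀ : Type u₀} [Category.{v₀} D₀] {V : FrdIMonoidStub.{w}} {T : RealifiedDivisorMonoids (D₀ := D₀) V}
  {D : Type u} [Category.{v} D] {r s : (Dᵒᵖ ⥤ CommMonCat.{w}) → Prop}
  (C : TemperedFrobenioid T D (treeCatVocab D r s)) (A₀ : D) (D' : Type u') [Category.{v'} D']
  (hD' : IsConnected D') (hD'' : IsTotallyEpimorphic D') (r' s' : (D'ᵒᵖ ⥤ CommMonCat.{w}) → Prop)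

/-- The pull-backs of `Φ^{bs-fld}` of the constant re-basing are identities (its structure functor is constant at `Y_{A₀}`; the fibres are
definitionally the same monoid `Φ^{bs-fld}(A₀)`). [cite: MochizukiEtTh2009, Def 3.6 p.77] -/
theorem constRebase_bsFld_pull_apply {A A' : D'ᵒᵖ} (g : A ⟶ A') (y : (C.constRebase A₀ D' hD' hD'' r' s').bsFld.carrier A) : (C.constRebase A₀ D' hD' hD'' r' s').bsFld.pull g y = y := by
  apply Subtype.ext
  change (T.ΦR.map (𝟙 (C.base.obj A₀)).op).hom y.1 = y.1
  rw [op_id, T.ΦR.map_id]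
  rfl

/-- Hence the pull-back HOMOMORPHISMS of `Φ^{bs-fld}` (as a monoid on `D'`) are identities. [cite: MochizukiEtTh2009, Def 3.6 p.77] -/
theorem constRebase_bsFldMonoid_map_eq_id {A A' : D'ᵒᵖ} (g : A ⟶ A') : ((C.constRebase A₀ D' hD' hD'' r' s').bsFldMonoid.map g).hom = MonoidHom.id _ :=
  MonoidHom.ext fun y => C.constRebase_bsFld_pull_apply A₀ D' hD' hD'' r' s' g y

/-- … and so are the transports `Φ^{bs-fld}(f)` on groupifications. [cite: MochizukiEtTh2009, Def 3.6 p.77] -/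
theorem constRebase_pullGp_bsFldMonoid {A A' : D'} (f : A ⟶ A') (c : Algebra.GrothendieckGroup ((C.constRebase A₀ D' hD' hD'' r' s').bsFldMonoid.obj (op A'))) :
    pullGp (C.constRebase A₀ D' hD' hD'' r' s').bsFldMonoid f c = c := by
  change MonGp.map ((C.constRebase A₀ D' hD' hD'' r' s').bsFldMonoid.map f.op).hom c = c
  rw [C.constRebase_bsFldMonoid_map_eq_id A₀ D' hD' hD'' r' s']
  exact DFunLike.congr_fun (MonGp.map_id (M := ↑((C.constRebase A₀ D' hD' hD'' r' s').bsFldMonoid.obj (op A')))) c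

/-- The pull-backs of the constant-function monoid `F^{bs}` of the constant re-basing are identities.
[cite: MochizukiEtTh2009, Def 3.6 p.78] -/
theorem constRebase_cnstFnBsFunctor_map_apply {A A' : D'ᵒᵖ} (g : A ⟶ A') (u : (C.constRebase A₀ D' hD' hD'' r' s').cnstFnBsFunctor.obj A) :
    ((C.constRebase A₀ D' hD' hD'' r' s').cnstFnBsFunctor.map g).hom u = u := by
  apply Subtype.ext
  apply Prod.ext
  · change (T.BΛ.map (𝟙 (C.base.obj A₀)).op).hom u.1.1 = u.1.1
    rw [op_id, T.BΛ.map_id]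
    rfl
  · change gpMap ((C.constRebase A₀ D' hD' hD'' r' s').bsFld.pull g) u.1.2 = u.1.2
    have h : (C.constRebase A₀ D' hD' hD'' r' s').bsFld.pull g = MonoidHom.id _ := MonoidHom.ext fun y => C.constRebase_bsFld_pull_apply A₀ D' hD' hD'' r' s' g y
    rw [h]
    exact DFunLike.congr_fun (gpMap_id (M := ↥((C.constRebase A₀ D' hD' hD'' r' s').bsFld.carrier A))) u.1.2

/-- **THE TAUTOLOGICAL LIFT.**  For EVERY self-equivalence `Θ` of the base `D'`, the base-field-theoretic hull `C_{A₀}^{bs-fld}` of the CONSTANT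
re-basing `C.constRebase A₀ D'` (the model Frobenioid of `(D', Φ^{bs-fld}, F^{bs}, Div)`, all of whose pull-backs are identities) has a self-equivalence
`Ψ` lying over `Θ` through its base functor: `(A, α) ↦ (Θ A, α)`, `(deg, f, Div, u) ↦ (deg, Θ f, Div, u)`, inverse from `Θ⁻¹`, unit and counit over
those of `Θ` (the fibres over `A` and `Θ A` are the same monoids; the proof moves elements by identity transports).  OURS (it carries no arithmetic).
[cite: MochizukiEtTh2009, Def 3.6 p.78] [cite: MochizukiFrdI2008, Thm. 5.2(i) p.100] -/
theorem exists_constRebase_hull_lift (Θ : D' ≌ D') :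
    ∃ Ψ : (C.constRebase A₀ D' hD' hD'' r' s').hullCategory ≌ (C.constRebase A₀ D' hD' hD'' r' s').hullCategory,
      Nonempty (Ψ.functor ⋙ ModelFrobenioid.baseFunctor _ _ (C.constRebase A₀ D' hD' hD'' r' s').divFNatTrans ≅ ModelFrobenioid.baseFunctor _ _ (C.constRebase A₀ D' hD' hD'' r' s').divFNatTrans ⋙ Θ.functor) := by
  -- identity transports between the (definitionally equal) fibres of the constant re-basing
  let trΦ : ∀ A A' : D'ᵒᵖ, ↑((C.constRebase A₀ D' hD' hD'' r' s').bsFldMonoid.obj A) → ↑((C.constRebase A₀ D' hD' hD'' r' s').bsFldMonoid.obj A') := fun _ _ y => y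
  let trB : ∀ A A' : D'ᵒᵖ, ↑((C.constRebase A₀ D' hD' hD'' r' s').cnstFnBsFunctor.obj A) → ↑((C.constRebase A₀ D' hD' hD'' r' s').cnstFnBsFunctor.obj A') := fun _ _ u => u
  let trG : ∀ A A' : D'ᵒᵖ, Algebra.GrothendieckGroup ↑((C.constRebase A₀ D' hD' hD'' r' s').bsFldMonoid.obj A) → Algebra.GrothendieckGroup ↑((C.constRebase A₀ D' hD' hD'' r' s').bsFldMonoid.obj A') :=
    fun _ _ c => c
  have hΦ : ∀ {A A' : D'ᵒᵖ} (g : A ⟶ A') (y : (C.constRebase A₀ D' hD' hD'' r' s').bsFldMonoid.obj A), ((C.constRebase A₀ D' hD' hD'' r' s').bsFldMonoid.map g).hom y = trΦ A A' y :=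
    fun g y => C.constRebase_bsFld_pull_apply A₀ D' hD' hD'' r' s' g y
  have hB : ∀ {A A' : D'ᵒᵖ} (g : A ⟶ A') (u : (C.constRebase A₀ D' hD' hD'' r' s').cnstFnBsFunctor.obj A), ((C.constRebase A₀ D' hD' hD'' r' s').cnstFnBsFunctor.map g).hom u = trB A A' u :=
    fun g u => C.constRebase_cnstFnBsFunctor_map_apply A₀ D' hD' hD'' r' s' g u
  have hgp : ∀ {A A' : D'} (f : A ⟶ A') (c : Algebra.GrothendieckGroup ((C.constRebase A₀ D' hD' hD'' r' s').bsFldMonoid.obj (op A'))),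
      pullGp (C.constRebase A₀ D' hD' hD'' r' s').bsFldMonoid f c = trG _ _ c :=
    fun f c => C.constRebase_pullGp_bsFldMonoid A₀ D' hD' hD'' r' s' f c
  have htrΦ : ∀ A A' : D'ᵒᵖ, trΦ A A' 1 = 1 := fun _ _ => rfl
  have htrB : ∀ A A' : D'ᵒᵖ, trB A A' 1 = 1 := fun _ _ => rfl
  -- the lift of an ENDOFUNCTOR `G` of `D'`
  let L : (D' ⥤ D') → ((C.constRebase A₀ D' hD' hD'' r' s').hullCategory ⥤ (C.constRebase A₀ D' hD' hD'' r' s').hullCategory) := fun G =>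
    { obj := fun Z => ⟨G.obj Z.base, trG _ _ Z.cls⟩
      map := fun {Z Z'} φ => ModelFrobenioid.mkHom _ _ (ModelFrobenioid.degFr φ) (G.map (ModelFrobenioid.baseMap φ))
        (trΦ _ _ (ModelFrobenioid.div φ)) (trB _ _ (ModelFrobenioid.unit φ)) (by
          have h := ModelFrobenioid.rel φ
          rw [hgp] at h ⊢
          exact h)
      map_id := fun Z => ModelFrobenioid.hom_ext rfl (G.map_id _) rfl rfl
      map_comp := fun {Z Z' Z''} φ ψ => by
        refine ModelFrobenioid.hom_ext rfl (G.map_comp _ _) ?_ ?_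
        · change trΦ _ _ (((C.constRebase A₀ D' hD' hD'' r' s').bsFldMonoid.map (ModelFrobenioid.baseMap φ).op).hom (ModelFrobenioid.div ψ) *
              ModelFrobenioid.div φ ^ (ModelFrobenioid.degFr ψ : ℕ)) =
            ((C.constRebase A₀ D' hD' hD'' r' s').bsFldMonoid.map (G.map (ModelFrobenioid.baseMap φ)).op).hom (trΦ _ _ (ModelFrobenioid.div ψ)) *
              trΦ _ _ (ModelFrobenioid.div φ) ^ (ModelFrobenioid.degFr ψ : ℕ)
          rw [hΦ, hΦ]
          rfl
        · change trB _ _ (((C.constRebase A₀ D' hD' hD'' r' s').cnstFnBsFunctor.map (ModelFrobenioid.baseMap φ).op).hom (ModelFrobenioid.unit ψ) *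
              ModelFrobenioid.unit φ ^ (ModelFrobenioid.degFr ψ : ℕ)) =
            ((C.constRebase A₀ D' hD' hD'' r' s').cnstFnBsFunctor.map (G.map (ModelFrobenioid.baseMap φ)).op).hom (trB _ _ (ModelFrobenioid.unit ψ)) *
              trB _ _ (ModelFrobenioid.unit φ) ^ (ModelFrobenioid.degFr ψ : ℕ)
          rw [hB, hB]
          rfl }
  -- the isomorphism of `(A, α)` with `(A', α)` over an isomorphism `A ≅ A'` of the base
  let isoOver : ∀ (Z : (C.constRebase A₀ D' hD' hD'' r' s').hullCategory) (A' : D') (e : Z.base ≅ A'), Z ≅ (⟨A', trG _ _ Z.cls⟩ : (C.constRebase A₀ D' hD' hD'' r' s').hullCategory) := fun Z A' e =>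
    { hom := ModelFrobenioid.mkHom Z ⟨A', trG _ _ Z.cls⟩ 1 e.hom 1 1 (by
        rw [hgp, PNat.one_coe, pow_one, map_one, map_one])
      inv := ModelFrobenioid.mkHom ⟨A', trG _ _ Z.cls⟩ Z 1 e.inv 1 1 (by
        rw [hgp, PNat.one_coe, pow_one, map_one, map_one])
      hom_inv_id := by
        refine ModelFrobenioid.hom_ext (mul_one _) e.hom_inv_id ?_ ?_
        · change ((C.constRebase A₀ D' hD' hD'' r' s').bsFldMonoid.map e.hom.op).hom 1 * 1 ^ ((1 : ℕ+) : ℕ) = 1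
          rw [map_one, one_pow, mul_one]
        · change ((C.constRebase A₀ D' hD' hD'' r' s').cnstFnBsFunctor.map e.hom.op).hom 1 * 1 ^ ((1 : ℕ+) : ℕ) = 1
          rw [map_one, one_pow, mul_one]
      inv_hom_id := by
        refine ModelFrobenioid.hom_ext (mul_one _) e.inv_hom_id ?_ ?_
        · change ((C.constRebase A₀ D' hD' hD'' r' s').bsFldMonoid.map e.inv.op).hom 1 * 1 ^ ((1 : ℕ+) : ℕ) = 1
          rw [map_one, one_pow, mul_one]
        · change ((C.constRebase A₀ D' hD' hD'' r' s').cnstFnBsFunctor.map e.inv.op).hom 1 * 1 ^ ((1 : ℕ+) : ℕ) = 1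
          rw [map_one, one_pow, mul_one] }
  -- the unit `𝟭 ≅ L Θ ⋙ L Θ⁻¹` and the counit `L Θ⁻¹ ⋙ L Θ ≅ 𝟭`, over those of `Θ`
  let η : 𝟭 (C.constRebase A₀ D' hD' hD'' r' s').hullCategory ≅ L Θ.functor ⋙ L Θ.inverse :=
    NatIso.ofComponents (fun Z => isoOver Z (Θ.inverse.obj (Θ.functor.obj Z.base)) (Θ.unitIso.app Z.base)) (fun {Z Z'} φ => by
      refine ModelFrobenioid.hom_ext ?_ ?_ ?_ ?_
      · change 1 * ModelFrobenioid.degFr φ = ModelFrobenioid.degFr φ * 1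
        rw [one_mul, mul_one]
      · exact Θ.unit.naturality (ModelFrobenioid.baseMap φ)
      · change trΦ _ (op Z.base) (((C.constRebase A₀ D' hD' hD'' r' s').bsFldMonoid.map (ModelFrobenioid.baseMap φ).op).hom (1 : (C.constRebase A₀ D' hD' hD'' r' s').bsFldMonoid.obj (op Z'.base))) *
            ModelFrobenioid.div φ ^ ((1 : ℕ+) : ℕ) =
          trΦ _ (op Z.base) (((C.constRebase A₀ D' hD' hD'' r' s').bsFldMonoid.map (Θ.unitIso.hom.app Z.base).op).hom (trΦ (op (Θ.functor.obj Z.base)) (op (Θ.inverse.obj (Θ.functor.obj Z.base)))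
              (trΦ (op Z.base) (op (Θ.functor.obj Z.base)) (ModelFrobenioid.div φ)))) *
            (1 : (C.constRebase A₀ D' hD' hD'' r' s').bsFldMonoid.obj (op Z.base)) ^ (ModelFrobenioid.degFr φ : ℕ)
        rw [map_one, htrΦ, one_mul, PNat.one_coe, pow_one, hΦ, one_pow, mul_one]
      · change trB _ (op Z.base) (((C.constRebase A₀ D' hD' hD'' r' s').cnstFnBsFunctor.map (ModelFrobenioid.baseMap φ).op).hom (1 : (C.constRebase A₀ D' hD' hD'' r' s').cnstFnBsFunctor.obj (op Z'.base))) *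
            ModelFrobenioid.unit φ ^ ((1 : ℕ+) : ℕ) =
          trB _ (op Z.base) (((C.constRebase A₀ D' hD' hD'' r' s').cnstFnBsFunctor.map (Θ.unitIso.hom.app Z.base).op).hom (trB (op (Θ.functor.obj Z.base)) (op (Θ.inverse.obj (Θ.functor.obj Z.base)))
              (trB (op Z.base) (op (Θ.functor.obj Z.base)) (ModelFrobenioid.unit φ)))) *
            (1 : (C.constRebase A₀ D' hD' hD'' r' s').cnstFnBsFunctor.obj (op Z.base)) ^ (ModelFrobenioid.degFr φ : ℕ)
        rw [map_one, htrB, one_mul, PNat.one_coe, pow_one, hB, one_pow, mul_one])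
  let ε : L Θ.inverse ⋙ L Θ.functor ≅ 𝟭 (C.constRebase A₀ D' hD' hD'' r' s').hullCategory :=
    NatIso.ofComponents (fun Z => (isoOver Z (Θ.functor.obj (Θ.inverse.obj Z.base)) (Θ.counitIso.app Z.base).symm).symm)
      (fun {Z Z'} φ => by
        refine ModelFrobenioid.hom_ext ?_ ?_ ?_ ?_
        · change 1 * ModelFrobenioid.degFr φ = ModelFrobenioid.degFr φ * 1
          rw [one_mul, mul_one]
        · exact Θ.counit.naturality (ModelFrobenioid.baseMap φ)
        · change trΦ _ (op (Θ.functor.obj (Θ.inverse.obj Z.base)))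
                (((C.constRebase A₀ D' hD' hD'' r' s').bsFldMonoid.map (Θ.functor.map (Θ.inverse.map (ModelFrobenioid.baseMap φ))).op).hom
                  (1 : (C.constRebase A₀ D' hD' hD'' r' s').bsFldMonoid.obj (op (Θ.functor.obj (Θ.inverse.obj Z'.base))))) *
              trΦ (op (Θ.inverse.obj Z.base)) (op (Θ.functor.obj (Θ.inverse.obj Z.base)))
                (trΦ (op Z.base) (op (Θ.inverse.obj Z.base)) (ModelFrobenioid.div φ)) ^ ((1 : ℕ+) : ℕ) =
            trΦ _ (op (Θ.functor.obj (Θ.inverse.obj Z.base))) (((C.constRebase A₀ D' hD' hD'' r' s').bsFldMonoid.map (Θ.counitIso.hom.app Z.base).op).hom (ModelFrobenioid.div φ)) *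
              (1 : (C.constRebase A₀ D' hD' hD'' r' s').bsFldMonoid.obj (op (Θ.functor.obj (Θ.inverse.obj Z.base)))) ^ (ModelFrobenioid.degFr φ : ℕ)
          rw [map_one, htrΦ, one_mul, PNat.one_coe, pow_one, hΦ, one_pow, mul_one]
        · change trB _ (op (Θ.functor.obj (Θ.inverse.obj Z.base)))
                (((C.constRebase A₀ D' hD' hD'' r' s').cnstFnBsFunctor.map (Θ.functor.map (Θ.inverse.map (ModelFrobenioid.baseMap φ))).op).hom
                  (1 : (C.constRebase A₀ D' hD' hD'' r' s').cnstFnBsFunctor.obj (op (Θ.functor.obj (Θ.inverse.obj Z'.base))))) *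
              trB (op (Θ.inverse.obj Z.base)) (op (Θ.functor.obj (Θ.inverse.obj Z.base)))
                (trB (op Z.base) (op (Θ.inverse.obj Z.base)) (ModelFrobenioid.unit φ)) ^ ((1 : ℕ+) : ℕ) =
            trB _ (op (Θ.functor.obj (Θ.inverse.obj Z.base))) (((C.constRebase A₀ D' hD' hD'' r' s').cnstFnBsFunctor.map (Θ.counitIso.hom.app Z.base).op).hom (ModelFrobenioid.unit φ)) *
              (1 : (C.constRebase A₀ D' hD' hD'' r' s').cnstFnBsFunctor.obj (op (Θ.functor.obj (Θ.inverse.obj Z.base)))) ^ (ModelFrobenioid.degFr φ : ℕ)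
          rw [map_one, htrB, one_mul, PNat.one_coe, pow_one, hB, one_pow, mul_one])
  refine ⟨CategoryTheory.Equivalence.mk (L Θ.functor) (L Θ.inverse) η ε, ⟨?_⟩⟩
  exact NatIso.ofComponents (fun Z => Iso.refl _) (fun {Z Z'} φ => by
    change Θ.functor.map (ModelFrobenioid.baseMap φ) ≫ 𝟙 _ = 𝟙 _ ≫ Θ.functor.map (ModelFrobenioid.baseMap φ)
    rw [Category.comp_id, Category.id_comp])

end TemperedFrobenioid

end Literature.AnabelianGeometry.EtaleTheta

/-! ### §2. Lifts on the two summands assemble to a lift on the sum -/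

namespace Literature.IUT.HodgeTheaters

namespace CatIsomorphism

universe v₁ v₂ v₃ u₁ u₂ u₃

variable {X : Type u₁} [Category.{v₁} X] {Y : Type u₂} [Category.{v₂} Y] {B : Type u₃} [Category.{v₃} B]

/-- **Summand-wise lifting.**  If a self-equivalence `Θ` of the base lifts through `inl ⋙ q` to a self-equivalence `Ψ_X` of `X` and through
`inr ⋙ q` to a self-equivalence `Ψ_Y` of `Y`, then it lifts through `q : X ⊕ Y ⥤ B` to the self-equivalence `Ψ_X ⊕ Ψ_Y` of the sum
(`Functor.sum'`, `Functor.sumIsoExt`; unit and counit summand-wise).  Category bookkeeping (OURS). ([IUTchI] Cor 5.3 (ii) p.144)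
[claim: Mochizuki2012, status: disputed] -/
theorem exists_sum_lift (q : X ⊕ Y ⥤ B) (Θ : B ≌ B)
    (hX : ∃ ΨX : X ≌ X, Nonempty (LiesUnder (Sum.inl_ X Y ⋙ q) (Sum.inl_ X Y ⋙ q) ΨX Θ))
    (hY : ∃ ΨY : Y ≌ Y, Nonempty (LiesUnder (Sum.inr_ X Y ⋙ q) (Sum.inr_ X Y ⋙ q) ΨY Θ)) :
    ∃ Ψ : X ⊕ Y ≌ X ⊕ Y, Nonempty (LiesUnder q q Ψ Θ) := by
  obtain ⟨eX, ⟨jX⟩⟩ := hX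
  obtain ⟨eY, ⟨jY⟩⟩ := hY
  -- the self-equivalence `eX ⊕ eY` of `X ⊕ Y` and its restrictions to the two summands
  let F : X ⊕ Y ⥤ X ⊕ Y := (eX.functor ⋙ Sum.inl_ X Y).sum' (eY.functor ⋙ Sum.inr_ X Y)
  let G : X ⊕ Y ⥤ X ⊕ Y := (eX.inverse ⋙ Sum.inl_ X Y).sum' (eY.inverse ⋙ Sum.inr_ X Y)
  let iFl : Sum.inl_ X Y ⋙ F ≅ eX.functor ⋙ Sum.inl_ X Y := Functor.inlCompSum' _ _
  let iFr : Sum.inr_ X Y ⋙ F ≅ eY.functor ⋙ Sum.inr_ X Y := Functor.inrCompSum' _ _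
  let iGl : Sum.inl_ X Y ⋙ G ≅ eX.inverse ⋙ Sum.inl_ X Y := Functor.inlCompSum' _ _
  let iGr : Sum.inr_ X Y ⋙ G ≅ eY.inverse ⋙ Sum.inr_ X Y := Functor.inrCompSum' _ _
  let η : 𝟭 (X ⊕ Y) ≅ F ⋙ G :=
    Functor.sumIsoExt
      ((Sum.inl_ X Y).rightUnitor ≪≫ (Sum.inl_ X Y).leftUnitor.symm ≪≫ Functor.isoWhiskerRight eX.unitIso (Sum.inl_ X Y) ≪≫
        Functor.associator _ _ _ ≪≫ Functor.isoWhiskerLeft eX.functor iGl.symm ≪≫ (Functor.associator _ _ _).symm ≪≫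
        Functor.isoWhiskerRight iFl.symm G ≪≫ Functor.associator _ _ _)
      ((Sum.inr_ X Y).rightUnitor ≪≫ (Sum.inr_ X Y).leftUnitor.symm ≪≫ Functor.isoWhiskerRight eY.unitIso (Sum.inr_ X Y) ≪≫
        Functor.associator _ _ _ ≪≫ Functor.isoWhiskerLeft eY.functor iGr.symm ≪≫ (Functor.associator _ _ _).symm ≪≫
        Functor.isoWhiskerRight iFr.symm G ≪≫ Functor.associator _ _ _)
  let ε : G ⋙ F ≅ 𝟭 (X ⊕ Y) :=
    Functor.sumIsoExt
      ((Functor.associator _ _ _).symm ≪≫ Functor.isoWhiskerRight iGl F ≪≫ Functor.associator _ _ _ ≪≫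
        Functor.isoWhiskerLeft eX.inverse iFl ≪≫ (Functor.associator _ _ _).symm ≪≫
        Functor.isoWhiskerRight eX.counitIso (Sum.inl_ X Y) ≪≫ (Sum.inl_ X Y).leftUnitor ≪≫ (Sum.inl_ X Y).rightUnitor.symm)
      ((Functor.associator _ _ _).symm ≪≫ Functor.isoWhiskerRight iGr F ≪≫ Functor.associator _ _ _ ≪≫
        Functor.isoWhiskerLeft eY.inverse iFr ≪≫ (Functor.associator _ _ _).symm ≪≫
        Functor.isoWhiskerRight eY.counitIso (Sum.inr_ X Y) ≪≫ (Sum.inr_ X Y).leftUnitor ≪≫ (Sum.inr_ X Y).rightUnitor.symm)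
  refine ⟨CategoryTheory.Equivalence.mk F G η ε, ⟨?_⟩⟩
  -- `eX ⊕ eY` lies under `Θ` through `q`, summand-wise
  exact Functor.sumIsoExt
      ((Functor.associator _ _ _).symm ≪≫ Functor.isoWhiskerRight iFl q ≪≫ Functor.associator _ _ _ ≪≫ jX ≪≫
        Functor.associator _ _ _)
      ((Functor.associator _ _ _).symm ≪≫ Functor.isoWhiskerRight iFr q ≪≫ Functor.associator _ _ _ ≪≫ jY ≪≫
        Functor.associator _ _ _)

end CatIsomorphism

end Literature.IUT.HodgeTheaters

end
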